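import Summits.NavierStokesRegularity.NavierStokesRegularity.Theorems.OddMorawetzLocal.Negative.OddMorawetzLocalRefutationData5
import Summits.NavierStokesRegularity.NavierStokesRegularity.Theorems.OddMorawetzLocal.Negative.OddMorawetzLocalRefutationDefsVI
import HarnessLib

/-!
# Crux `OddMorawetzLocal` (stmt-NavierStokesRegularity-1376) — kernel certificates, weight 5 (part B5)

The finite computations of the weight-5 half of the refutation, each a closed Boolean evaluated by the kernel
(`decide +kernel`) on the vocabulary of `OddMorawetzLocalJetAlgebra` / `…RefutationDefs{,Fast,IV,V,VI}` and the literal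
data of `…RefutationData5` (197 representatives, 50 isotropic descriptors, certificate blocks of 53/45/49 rows, prime 8191).
Part B5: the shape bookkeeping (`cert5_shape`, `cert5_disjoint`), index ranges (`cert5_ranges`), sizes (`cert5_sizes`),
canonicity of the representatives (`cert5_reps_canonical`) and the derivative orders of the isotropic fluxes (`cert5_iso_fluxord`).
No analysis; lands `--supports` the crux item; consumed by the weight-5 assembly of the refutation.
-/

set_option linter.dupNamespace false
set_option maxRecDepth 20000

namespace Summit.NavierStokesRegularity.NavierStokesRegularity.Theorems.OddMorawetz

/-- The derivation columns of the certificate representatives stay inside their shape blocks. -/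
theorem cert5_shape : colShapePure reps5 (certCols blocks5) = true := by decide +kernel

/-- Rows of one certificate block never have the shape of a column representative of another block. -/
theorem cert5_disjoint : blockShapesDisjoint 5 reps5 blocks5 = true := by decide +kernel

/-- Index ranges and sizes of the weight-5 certificate data are consistent. -/
theorem cert5_ranges : certRangesOk 5 reps5 blocks5 kcols5 cinv5 50 = true := by decide +kernel

/-- Size bookkeeping of the weight-5 data (i): 4509 basis monomials, 197 representatives, 50 isotropic basis elements,
three certificate blocks. -/
theorem cert5_sizes : (idx 5).length = 4509 ∧ reps5.length = 197 ∧ isoDesc5.length = 50 ∧ blocks5.length = 3 := by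
  refine ⟨by decide +kernel, by decide +kernel, by decide +kernel, by decide +kernel⟩

/-- Size bookkeeping of the weight-5 data (ii): 147 certificate rows and columns, 50 independence columns / inverse rows. -/
theorem cert5_sizes' : (certRows blocks5).length = 147 ∧ (certCols blocks5).length = 147 ∧ kcols5.length = 50 ∧
    cinv5.length = 50 := by
  refine ⟨by decide +kernel, by decide +kernel, by decide +kernel, by decide +kernel⟩

/-- Every weight-5 orbit representative is a canonical weight-5 cubic monomial (hence a basis monomial of `idx 5`, by
`mem_idx_of_canonical_check` applied to the list with unit coefficients). -/
theorem cert5_reps_canonical : ((reps5.map fun m => ((1 : ℤ), m)).all fun t =>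
      decide (sortVars t.2 = t.2) && decide (t.2.length = 3) && decide (monoWeight t.2 = 5) &&
        t.2.all fun v => decide (sortIdx v.2 = v.2) && decide (v.2.length ≤ 3)) = true := by
  decide +kernel

/-- The isotropic fluxes behind the `null` descriptors only involve jets of order `≤ 3`. -/
theorem cert5_iso_fluxord : (isoDesc5.all fun d => match d with
      | .null sh mt => [isoFlux sh mt 0, isoFlux sh mt 1, isoFlux sh mt 2].all fun F =>
          F.all fun t => t.2.all fun u => decide (u.2.length ≤ 3)
      | _ => true) = true := by
  decide +kernel

end Summit.NavierStokesRegularity.NavierStokesRegularity.Theorems.OddMorawetz
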